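import Literature.MathematicalPhysics.QuantumFieldTheory.Balaban1983to89.B9Thm32CinvAtMemberOfCubeData
import Literature.MathematicalPhysics.QuantumFieldTheory.Balaban1983to89.B9ThmDAtDatum

/-!
# `Balaban1983to89.B9Thm32CinvAtMemberOfCubeDataThmD` — THEOREMS 3.7 + 3.9 + D ⇒ THEOREM 3.2 (3.48) FOR `C(U) = (Q′G′²Q′*)⁻¹(U)` AT A `U(N)`-VALUED
# (3.35)-REGULAR BACKGROUND, FOR EVERY MEMBER ABOVE ONE THRESHOLD, FROM THE PER-CUBE (3.35) DATA — p33 FILE 10 WITH ITS DISPLAYED THEOREM-D BINDER `hD`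
# DISCHARGED BY p21 FILE D6 (`B9ThmDAtDatum.thmD_cover_binders`)

T. Bałaban, *Propagators for lattice gauge theories in a background field*, Commun. Math. Phys. **99** (1985) 389–434 [`Balaban1985BackgroundPropagators`, "[B9]"];
[4] = T. Bałaban, *Propagators and renormalization transformations for lattice gauge theories. II*, Commun. Math. Phys. **96** (1984) 223–250 [`Balaban1984PropagatorsII`];
[2] of [B9] = T. Bałaban, *Regularity and decay of lattice Green's functions*, Commun. Math. Phys. **89** (1983) 571–597 [`Balaban1983RegularityDecay`].

statement-level skeleton of published theorems with citation tags; proofs where landed; nothing here is a claim about the Yang–Mills mass gap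

THE PRINT (held `paper:balaban1985-cmp99-background-propagators`, journal page = PDF page + 388).  Thm 3.2 (3.48) p. 398; Thm 3.9 p. 413 («For M sufficiently large
… Theorem 3.2 holds»); (3.95)–(3.97) pp. 411–412 with the Theorem D paragraph p. 412 l. 1–9; Thm 3.7 pp. 409–410; Cor. 3.6 p. 408; Thm 3.11 p. 416.

WHAT THIS FILE PROVES (TWO THEOREMS; 0 `def`; 0 sorry).  §1 ★★★ `hDf_of_cubeData_unitary` — FILE 10's∕11's binder `hDf` AS A THEOREM from the cube data (the
per-member supplier p33 g99's knit-level plug consumes BY NAME); §2 ★★★ `cinv_at_member_of_cubeData_thmD` — p33's `B9Thm32CinvAtMemberOfCubeData.cinv_at_member_of_cubeData_unitary`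
with the hypothesis `hD` (the localized [2]-difference majorants, cell GAPS G-B9-05) REMOVED: it is supplied by p21's `B9ThmDAtDatum.thmD_cover_binders` at the member
letter's constants `(A, δ_G) := (M₂Σ‖b‖K_G, δ_G)` of FILE 9 (`eBlock_GpY_of_cubeData_unitary`), the member letter's (3.42)₀ site majorant read from its `EBlock` by
`B9CubeLettersInvReadDict.hasMajorant_conj_G_of_eBlockInv`, `IsUnit Δ′_a(U; parSymY)` by `isUnit_deltaPrimeAY_parSymY`, contractive `parSymY(U)` by unitarity.
Conclusion: for `G ≤ U(N)`, `N ≥ 1`, walk data `(Rr, Hp)`, a real basis `b` of `M_N(ℂ)` with coordinate bound `M₂`: `∃ δ > 0, K ≥ 0, M₀, T₀, N₀, a₁ > 0`, for every member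
above the thresholds with `c_f = L^k`, every section `ιB`, every `G`-valued `U`, every family of per-cube (3.35) data (E2-6 ∕ FILE 9 binders) and every background family
through `U`: `conj b((η²η²)⁻¹•(Q′G′²Q′*)⁻¹(U; parSymY)) ≺ K·ℓ(a)⁻⁴·e^{−δd(a,a′)}` on the block carrier — THEOREM 3.2 (3.48) for `C(U)`.

HONEST SCOPE / NOT CLAIMED.  Composition of landed theorems; NO estimate of [B9] is proved here.  DISPLAYED: the per-cube (3.35) data family (which class cube supplies
`Q_□ ⊇ NearC_□(35S_j/8 + 1)` is FILE 4's open question), the member thresholds (existential), `c_f = L^k`, `ιB`, `N ≥ 1`, the basis datum.  Theorem D enters through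
p21's files D1–D6, a LABELLED DEVIATION from print's road via [2] Sect. 5 (no second random-walk expansion; printed shape kept).  Sup-entry (3.48) only; finite 𝕋
members of the k-level V1 family; count-neutral; no summit ∕ sub-problem statement is proved; nothing continuum ∕ OS ∕ mass-gap ∕ Clay; NOT a node discharge.
No `sorry`, no `axiom`, no `… : Prop` fact, no `instance`, no `notation`, no `def`.  NEW file; nothing landed is modified.  Cell `lit-balaban`, seat `lit-balaban-p21`
gen 35, 2026-08-28; `--supports stmt-QuantumFields-19200`.  Net new unproved facts: 0.
-/

noncomputable section

open scoped BigOperators Matrix Matrix.Norms.L2Operator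

namespace Literature.MathematicalPhysics.QuantumFieldTheory.Balaban1983to89.B9Thm32CinvAtMemberOfCubeDataThmD

open B4PartitionUnity22 (thetaProf D1)
open B9Eq39Adjoint (fluct covD)
open B6KLevelCensusIndexV1 (KIdx kGeo)
open B6Cover236MultiLevelBlocks (cubes)
open B6GlobalChartV1 (PV boxEquiv)
open B6Ineq2142KLevelV1 (β)
open B6RandomWalk (HasMajorant hasMajorant_mono)
open B9BackgroundsKLevelV1 (shiftsV1)
open B9Eq352DivFormLetters (conj)
open B9Eq360DeltaPrimeAY (AfldY)
open B9CubeGeometryInputs (RM1)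
open B9GeoNormsKLevelV1 (geo9K)
open B9Thm34Ext (toB6)
open B9Cor36CubeCutoffs (SC NearC chiY locCfgY)
open B9Cor36GpCubeLocLetter (locLetterY)
open B6Cover236MultiLevelTorusBlocks (cubeIndT)
open B9GeoLemma21KLevelV1 (one_le_Mh)
open B9Thm37CubeCoverCommutators (cutMulY)
open B9Thm37CubeCoverCommutatorSizes (four_le_P')
open B9Thm39CinvAtCover (chiBigT DsepT)
open B9Cor36GpCoverBindersUnitary (eBlock_GpY_of_cubeData_unitary bicontractive_of_mem)
open B9Thm37GpAtCoverLarge (geo9K_M_eq')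
open B9Thm32CinvAtMemberOfCubeData (cinv_at_member_of_cubeData_unitary)
open B9ThmDAtDatum (thmD_cover_binders)
open B9Thm311DeltaPrimePos (isUnit_deltaPrimeAY_parSymY)
open B9CubeLettersInvReadDict (hasMajorant_conj_G_of_eBlockInv)
open B7Prop2Explicit (unitaryUnits)
open Node00 (SiteY BlkY CfgY GaugeY IBondY toKT gaugeY parSymY parSymY_mem XY XinvY GpY etaS)

variable {d ℓ : ℕ} {hd : 1 ≤ d + 1} {hL : Odd (ℓ + 1) ∧ 1 < ℓ + 1} {b₀ b₁ : ℝ}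
variable {N : ℕ} {G : Subgroup (Matrix (Fin N) (Fin N) ℂ)ˣ}
variable {ι : Type} [Fintype ι] [DecidableEq ι] (b : Module.Basis ι ℝ (Matrix (Fin N) (Fin N) ℂ))

/-! ## §1 ★★★ The Theorem-D binder of FILE 10 ∕ FILE 11 from the cube data, at a `U(N)`-valued background -/

/-- ★★★ **THE THEOREM-D BINDER `hDf` OF p33's FILES 10∕11 AS A THEOREM, FROM THE PER-CUBE (3.35) DATA AT A `U(N)`-VALUED BACKGROUND** (p21 D6 `thmD_cover_binders` at
the member letter's constants `(A, δ_G) := (M₂Σ‖b‖K_G, δ_G)` of FILE 9, its (3.42)₀ site majorant read from the `EBlock` by `hasMajorant_conj_G_of_eBlockInv`, `IsUnit Δ′_a(U;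
parSymY)` by `isUnit_deltaPrimeAY_parSymY`, contractive `parSymY(U)` by unitarity, `(geo9K i).M = (ℓ+1)M_h`): `∃ δ_D > 0, κ_D ≥ 0, M₀, T₀, N₀, a₁ > 0` such that for every
member above the thresholds with `c_f = L^k`, every `ιB`, every `G`-valued `U`, every family of per-cube (3.35) data, every background family through `U`, every rate
`0 ≤ a ≤ δ_D` and every cube: `conj b((η²η²)•M_{χ̃_□}(XY(G′)(U) − XY(O_□)(U))M_{1_{□⁺}}) ≺ κ_D·e^{−2δ_D·D_sep}·ℓ(a)⁴·e^{−a·d}` — FILE 10's `hDf` VERBATIM.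
[cite: Balaban1985BackgroundPropagators, p.412 l.1–9, (3.97) p.412, Cor. 3.6 p.408, Thm 3.1 (3.42) p.397, Thm 3.11 p.416; Balaban1983RegularityDecay, Thm (5.8) p.594; Balaban1984PropagatorsII, (2.83) p.237] -/
theorem hDf_of_cubeData_unitary [Nonempty (Fin N)] [∀ i' : KIdx d ℓ hd hL b₀ b₁, Fintype (geo9K i').Site]
    [∀ i' : KIdx d ℓ hd hL b₀ b₁, DecidableEq (geo9K i').Site] (hG : G ≤ unitaryUnits (Matrix (Fin N) (Fin N) ℂ))
    (Rr : KIdx d ℓ hd hL b₀ b₁ → ℝ) (Hp : KIdx d ℓ hd hL b₀ b₁ → Prop)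
    (hℓ : 1 ≤ ℓ) {M₂ : ℝ} (hM₂ : 0 ≤ M₂) (hrepr : ∀ (v : Matrix (Fin N) (Fin N) ℂ) (j : ι), |b.repr v j| ≤ M₂ * ‖v‖) :
    ∃ δD κD M₀ T₀ : ℝ, ∃ N₀ : ℕ, 0 < δD ∧ 0 ≤ κD ∧ ∃ a₁ : ℝ, 0 < a₁ ∧
    ∀ (i : KIdx d ℓ hd hL b₀ b₁),
      M₀ ≤ ((ℓ : ℝ) + 1) * (toKT i).Mh → N₀ + 1 ≤ (toKT i).R * ((ℓ + 1) * (toKT i).Mh) → T₀ ≤ RM1 i → i.cf = (((ℓ + 1 : ℕ) : ℝ)) ^ i.k →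
    ∀ (ιB : BlkY i → IBondY i), (∀ s, β i.hN i.D i.hk (ιB s) = s) →
    ∀ (U : CfgY (Matrix (Fin N) (Fin N) ℂ) i), (∀ μ x, U μ x ∈ G) →
    ∀ (g : ↥(cubes (toKT i).D.toDomains) → GaugeY (Matrix (Fin N) (Fin N) ℂ) i),
      (∀ c x, ‖(g c x : Matrix (Fin N) (Fin N) ℂ)‖ ≤ 1 ∧ ‖(((g c x)⁻¹ : (Matrix (Fin N) (Fin N) ℂ)ˣ) : Matrix (Fin N) (Fin N) ℂ)‖ ≤ 1) →
    ∀ (A : ↥(cubes (toKT i).D.toDomains) → AfldY (Matrix (Fin N) (Fin N) ℂ) i)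
      (Q : ↥(cubes (toKT i).D.toDomains) → Set (Site (PV d ℓ i.m i.K hd hL) 0)) (C ξ Λ : ↥(cubes (toKT i).D.toDomains) → ℝ),
      (∀ c, 0 ≤ C c) → (∀ c, 0 < ξ c) → (∀ c, 1 ≤ Λ c) → (∀ c, ξ c ≤ 5 * (SC i c : ℝ) * (kGeo i).eta) →
      (∀ c, LatticeNorms.scaleLen ((ℓ : ℝ) + 1) (kGeo i).eta (c.1.1 + 1) ≤ Λ c * ξ c) →
      (∀ c, ∀ x : Site (PV d ℓ i.m i.K hd hL) 0, NearC i c (35 * SC i c / 8 + 1) (boxEquiv i.hN x).1 → x ∈ Q c) →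
      (∀ c, ∀ (κ : Fin (d + 1)) (x : Site (PV d ℓ i.m i.K hd hL) 0), x ∈ Q c → x.shift κ ∈ Q c →
        gaugeY i (g c) U κ x = fluct (kGeo i).eta (A c) κ x) →
      (∀ c, ∀ κ, ∀ x ∈ Q c, ‖A c κ x‖ ≤ C c * (ξ c)⁻¹) →
      (∀ c, ∀ μ ν, ∀ x ∈ Q c,
        ‖(((kGeo i).eta : ℂ)⁻¹) • covD (shiftsV1 (PV d ℓ i.m i.K hd hL)) (fun _ _ => (1 : (Matrix (Fin N) (Fin N) ℂ)ˣ)) μ (A c ν) x‖ ≤ C c * (ξ c ^ 2)⁻¹) →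
      (∀ c, max (C c) (C c * (1 + D1 thetaProf)) * Λ c ^ 2 ≤ a₁) → (∀ c, max (C c) (C c * (1 + D1 thetaProf)) * Λ c ^ 2 ≤ 1 / 4) →
    ∀ {B : B9.Backgrounds} (cfg : B.Cfg → CfgY (Matrix (Fin N) (Fin N) ℂ) i) (U₁ : B.Cfg), cfg U₁ = U →
    ∀ a : ℝ, 0 ≤ a → a ≤ δD → ∀ c : ↥(cubes (toKT i).D.toDomains),
      HasMajorant (g := toB6 (geo9K i) (Rr i) (Hp i)) (fun p : BlkY i × ι => ιB p.1)
        (conj b ((etaS i ^ 2 * etaS i ^ 2) • ((cutMulY (𝔸 := Matrix (Fin N) (Fin N) ℂ) (chiBigT i c)).restrictScalars ℝ *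
          ((XY i (parSymY i) (GpY i (parSymY i)) U).restrictScalars ℝ -
            (XY i (parSymY i) (fun _ => locLetterY i c (parSymY i) (g c) (chiY i c) (locCfgY i c (kGeo i).eta (A c))) U).restrictScalars ℝ) *
          (cutMulY (𝔸 := Matrix (Fin N) (Fin N) ℂ) (cubeIndT i.D (one_le_Mh i) (four_le_P' i) c)).restrictScalars ℝ)))
        (fun a₀ a'' => κD * Real.exp (-(2 * δD * DsepT i)) * (geo9K i).len a₀ ^ 4 * Real.exp (-(a * (geo9K i).dist a₀ a''))) := by
  have hSb : 0 ≤ ∑ j, ‖b j‖ := Finset.sum_nonneg fun _ _ => norm_nonneg _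
  -- FILE 9: the member letter's (3.42) block `(δ_G, K_G)`
  obtain ⟨δG, KG, M₀g, T₀g, N₀g, hδG, hKG, a₁g, ha₁g, HG⟩ := eBlock_GpY_of_cubeData_unitary b hG Rr Hp hℓ hM₂ hrepr
  have hA : 0 ≤ M₂ * (∑ j, ‖b j‖) * KG := mul_nonneg (mul_nonneg hM₂ hSb) hKG
  -- FILE D6: Theorem D's `(δ_D, κ_D)` at `(A, δ_G) := (M₂Σ‖b‖K_G, δ_G)`
  obtain ⟨ML, M₀d, T₀d, N₀d, a₁d, ha₁d, δD, κD, hδD, hκD, HD⟩ :=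
    thmD_cover_binders (𝔸 := Matrix (Fin N) (Fin N) ℂ) b Rr Hp hℓ hM₂ hrepr hA hδG
  refine ⟨δD, κD, max M₀g (max M₀d ML), max T₀g T₀d, max N₀g N₀d, hδD, hκD, min a₁g a₁d, lt_min ha₁g ha₁d, ?_⟩
  intro i hM hN hT hcf ιB hι U hU g hu A Q C ξ Λ hC0 hξ hΛ hξS hΛξ hQ hgA hA' hdA hα₁ hα4 B cfg U₁ hcfg a ha0 ha c
  have hM₀g : M₀g ≤ ((ℓ : ℝ) + 1) * (toKT i).Mh := (le_max_left _ _).trans hM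
  have hM₀d : M₀d ≤ ((ℓ : ℝ) + 1) * (toKT i).Mh := ((le_max_left _ _).trans (le_max_right _ _)).trans hM
  have hML : ML ≤ (geo9K i).M := by
    rw [geo9K_M_eq' i]; exact ((le_max_right _ _).trans (le_max_right _ _)).trans hM
  have hN₀g : N₀g + 1 ≤ (toKT i).R * ((ℓ + 1) * (toKT i).Mh) := (Nat.add_le_add_right (le_max_left _ _) 1).trans hN
  have hN₀d : N₀d + 1 ≤ (toKT i).R * ((ℓ + 1) * (toKT i).Mh) := (Nat.add_le_add_right (le_max_right _ _) 1).trans hN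
  have hT₀g : T₀g ≤ RM1 i := (le_max_left _ _).trans hT
  have hT₀d : T₀d ≤ RM1 i := (le_max_right _ _).trans hT
  have hα₁G : ∀ c, max (C c) (C c * (1 + D1 thetaProf)) * Λ c ^ 2 ≤ a₁g := fun c => (hα₁ c).trans (min_le_left _ _)
  have hα₁D : ∀ c, max (C c) (C c * (1 + D1 thetaProf)) * Λ c ^ 2 ≤ a₁d := fun c => (hα₁ c).trans (min_le_right _ _)
  -- the member letter's (3.42) block and its (3.42)₀ site majorant
  obtain ⟨hE, -⟩ := HG i hM₀g hN₀g hT₀g hcf ιB hι U hU g hu A Q C ξ Λ hC0 hξ hΛ hξS hΛξ hQ hgA hA' hdA hα₁G hα4 cfg U₁ hcfg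
  subst hcfg
  have hGm := hasMajorant_conj_G_of_eBlockInv i b cfg (GpY i (parSymY i)) (parSymY i) (Rr := Rr i) (Hp := Hp i) hE hKG ιB hι hM₂ hrepr rfl
    ((etaS i ^ 2) • (GpY i (parSymY i) (cfg U₁)).restrictScalars ℝ) (fun _ => rfl)
  -- Thm 3.11 ∕ unitarity: `Δ′_a(U; parSymY)` is a unit, `parSymY(U)` is contractive
  have hUunit : IsUnit (Node00.deltaPrimeAY i (parSymY i) (cfg U₁)) := isUnit_deltaPrimeAY_parSymY (i := i) hG hU
  have hpar : ∀ z w : SiteY i, ‖(parSymY i (cfg U₁) z w : Matrix (Fin N) (Fin N) ℂ)‖ ≤ 1 ∧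
      ‖(((parSymY i (cfg U₁) z w)⁻¹ : (Matrix (Fin N) (Fin N) ℂ)ˣ) : Matrix (Fin N) (Fin N) ℂ)‖ ≤ 1 :=
    fun z w => bicontractive_of_mem hG (parSymY_mem i hU z w)
  exact HD i hML hM₀d hN₀d hT₀d hcf ιB hι (cfg U₁) hUunit hpar hGm g hu A Q C ξ Λ hC0 hξ hΛ hξS hΛξ hQ hgA hA' hdA hα₁D hα4 a ha0 ha c

/-! ## §2 ★★★ Theorem 3.2 (3.48) for `C(U)` at the member, unconditional in Theorem D -/

/-- ★★★ **THEOREMS 3.7 + 3.9 + D ⇒ THEOREM 3.2 (3.48) FOR `C(U) = (Q′G′²Q′*)⁻¹(U)` AT A `U(N)`-VALUED (3.35)-REGULAR BACKGROUND, FOR EVERY MEMBER ABOVE ONE THRESHOLD,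
FROM THE PER-CUBE (3.35) DATA** — p33 FILE 10 with the Theorem-D binder discharged by §1: for `G ≤ U(N)`, `N ≥ 1`, walk data `(Rr, Hp)` and a real basis `b`
of `M_N(ℂ)` with coordinate bound `M₂`, there are `δ > 0`, `K ≥ 0`, thresholds `M₀, T₀, N₀` and `a₁ > 0` such that for every member above the thresholds with
`c_f = L^k`, every section `ιB`, every `G`-valued `U`, every family of per-cube (3.35) data — bi-contractive gauges `u_□`, potentials `A_□` on torus sets
`Q_□ ⊇ NearC_□(35S_j∕8 + 1)` with `U^{u_□} = e^{iηA_□}` on their bonds, `‖A_□‖ ≦ C_□ξ_□⁻¹`, `‖η⁻¹∂A_□‖ ≦ C_□ξ_□⁻²`, `0 < ξ_□ ≦ 5S_jη`, `L^{j+1}η ≦ Λ_□ξ_□`,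
`1 ≦ Λ_□`, `max C_□ (C_□(1+D₁θ))Λ_□² ≦ min(a₁, 1∕4)` — and every background family through `U`:
`conj b((η²η²)⁻¹•(Q′G′²Q′*)⁻¹(U; parSymY)) ≺ K·ℓ(a)⁻⁴·e^{−δ·d(a,a′)}`.
[cite: Balaban1985BackgroundPropagators, Thm 3.2 (3.48) p.398, Thm 3.9 p.413, (3.95)–(3.97) pp.411–412, p.412 l.1–9, Thm 3.7 pp.409–410, Cor. 3.6 p.408, Thm 3.11 p.416; Balaban1984PropagatorsII, (2.83)–(2.87) pp.237–238, Lemma 2.1 p.234] -/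
theorem cinv_at_member_of_cubeData_thmD [Nonempty (Fin N)] [∀ i' : KIdx d ℓ hd hL b₀ b₁, Fintype (geo9K i').Site]
    [∀ i' : KIdx d ℓ hd hL b₀ b₁, DecidableEq (geo9K i').Site] (hG : G ≤ unitaryUnits (Matrix (Fin N) (Fin N) ℂ))
    (Rr : KIdx d ℓ hd hL b₀ b₁ → ℝ) (Hp : KIdx d ℓ hd hL b₀ b₁ → Prop)
    (hℓ : 1 ≤ ℓ) {M₂ : ℝ} (hM₂ : 0 ≤ M₂) (hrepr : ∀ (v : Matrix (Fin N) (Fin N) ℂ) (j : ι), |b.repr v j| ≤ M₂ * ‖v‖) :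
    ∃ δ K M₀ T₀ : ℝ, ∃ N₀ : ℕ, 0 < δ ∧ 0 ≤ K ∧ ∃ a₁ : ℝ, 0 < a₁ ∧
    ∀ (i : KIdx d ℓ hd hL b₀ b₁),
      M₀ ≤ ((ℓ : ℝ) + 1) * (toKT i).Mh → N₀ + 1 ≤ (toKT i).R * ((ℓ + 1) * (toKT i).Mh) → T₀ ≤ RM1 i → i.cf = (((ℓ + 1 : ℕ) : ℝ)) ^ i.k →
    ∀ (ιB : BlkY i → IBondY i), (∀ s, β i.hN i.D i.hk (ιB s) = s) →
    ∀ (U : CfgY (Matrix (Fin N) (Fin N) ℂ) i), (∀ μ x, U μ x ∈ G) →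
    ∀ (g : ↥(cubes (toKT i).D.toDomains) → GaugeY (Matrix (Fin N) (Fin N) ℂ) i),
      (∀ c x, ‖(g c x : Matrix (Fin N) (Fin N) ℂ)‖ ≤ 1 ∧ ‖(((g c x)⁻¹ : (Matrix (Fin N) (Fin N) ℂ)ˣ) : Matrix (Fin N) (Fin N) ℂ)‖ ≤ 1) →
    ∀ (A : ↥(cubes (toKT i).D.toDomains) → AfldY (Matrix (Fin N) (Fin N) ℂ) i)
      (Q : ↥(cubes (toKT i).D.toDomains) → Set (Site (PV d ℓ i.m i.K hd hL) 0)) (C ξ Λ : ↥(cubes (toKT i).D.toDomains) → ℝ),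
      (∀ c, 0 ≤ C c) → (∀ c, 0 < ξ c) → (∀ c, 1 ≤ Λ c) → (∀ c, ξ c ≤ 5 * (SC i c : ℝ) * (kGeo i).eta) →
      (∀ c, LatticeNorms.scaleLen ((ℓ : ℝ) + 1) (kGeo i).eta (c.1.1 + 1) ≤ Λ c * ξ c) →
      (∀ c, ∀ x : Site (PV d ℓ i.m i.K hd hL) 0, NearC i c (35 * SC i c / 8 + 1) (boxEquiv i.hN x).1 → x ∈ Q c) →
      (∀ c, ∀ (κ : Fin (d + 1)) (x : Site (PV d ℓ i.m i.K hd hL) 0), x ∈ Q c → x.shift κ ∈ Q c →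
        gaugeY i (g c) U κ x = fluct (kGeo i).eta (A c) κ x) →
      (∀ c, ∀ κ, ∀ x ∈ Q c, ‖A c κ x‖ ≤ C c * (ξ c)⁻¹) →
      (∀ c, ∀ μ ν, ∀ x ∈ Q c,
        ‖(((kGeo i).eta : ℂ)⁻¹) • covD (shiftsV1 (PV d ℓ i.m i.K hd hL)) (fun _ _ => (1 : (Matrix (Fin N) (Fin N) ℂ)ˣ)) μ (A c ν) x‖ ≤ C c * (ξ c ^ 2)⁻¹) →
      (∀ c, max (C c) (C c * (1 + D1 thetaProf)) * Λ c ^ 2 ≤ a₁) → (∀ c, max (C c) (C c * (1 + D1 thetaProf)) * Λ c ^ 2 ≤ 1 / 4) →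
    ∀ {B : B9.Backgrounds} (cfg : B.Cfg → CfgY (Matrix (Fin N) (Fin N) ℂ) i) (U₁ : B.Cfg), cfg U₁ = U →
      HasMajorant (g := toB6 (geo9K i) (Rr i) (Hp i)) (fun p : BlkY i × ι => ιB p.1)
        (conj b ((etaS i ^ 2 * etaS i ^ 2)⁻¹ • (XinvY i (parSymY i) (GpY i (parSymY i)) U).restrictScalars ℝ))
        (fun a a' => K * ((geo9K i).len a ^ 4)⁻¹ * Real.exp (-(δ * (geo9K i).dist a a'))) := by
  -- §1: Theorem D's binder `(δ_D, κ_D)`; FILE 10 at `(κ_D, δ_D)`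
  obtain ⟨δD, κD, M₀d, T₀d, N₀d, hδD, hκD, a₁d, ha₁d, HD⟩ := hDf_of_cubeData_unitary b hG Rr Hp hℓ hM₂ hrepr
  obtain ⟨δ, K, M₀, T₀, N₀, hδ, hK, a₁, ha₁, HM⟩ := cinv_at_member_of_cubeData_unitary b hG Rr Hp hℓ hM₂ hrepr hκD hδD
  refine ⟨δ, K, max M₀ M₀d, max T₀ T₀d, max N₀ N₀d, hδ, hK, min a₁ a₁d, lt_min ha₁ ha₁d, ?_⟩
  intro i hM hN hT hcf ιB hι U hU g hu A Q C ξ Λ hC0 hξ hΛ hξS hΛξ hQ hgA hA' hdA hα₁ hα4 B cfg U₁ hcfg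
  have hM₀ : M₀ ≤ ((ℓ : ℝ) + 1) * (toKT i).Mh := (le_max_left _ _).trans hM
  have hM₀d : M₀d ≤ ((ℓ : ℝ) + 1) * (toKT i).Mh := (le_max_right _ _).trans hM
  have hN₀ : N₀ + 1 ≤ (toKT i).R * ((ℓ + 1) * (toKT i).Mh) := (Nat.add_le_add_right (le_max_left _ _) 1).trans hN
  have hN₀d : N₀d + 1 ≤ (toKT i).R * ((ℓ + 1) * (toKT i).Mh) := (Nat.add_le_add_right (le_max_right _ _) 1).trans hN
  have hT₀ : T₀ ≤ RM1 i := (le_max_left _ _).trans hT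
  have hT₀d : T₀d ≤ RM1 i := (le_max_right _ _).trans hT
  have hα₁M : ∀ c, max (C c) (C c * (1 + D1 thetaProf)) * Λ c ^ 2 ≤ a₁ := fun c => (hα₁ c).trans (min_le_left _ _)
  have hα₁D : ∀ c, max (C c) (C c * (1 + D1 thetaProf)) * Λ c ^ 2 ≤ a₁d := fun c => (hα₁ c).trans (min_le_right _ _)
  have hDf := HD i hM₀d hN₀d hT₀d hcf ιB hι U hU g hu A Q C ξ Λ hC0 hξ hΛ hξS hΛξ hQ hgA hA' hdA hα₁D hα4 cfg U₁ hcfg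
  exact HM i hM₀ hN₀ hT₀ hcf ιB hι U hU g hu A Q C ξ Λ hC0 hξ hΛ hξS hΛξ hQ hgA hA' hdA hα₁M hα4 cfg U₁ hcfg hDf

end Literature.MathematicalPhysics.QuantumFieldTheory.Balaban1983to89.B9Thm32CinvAtMemberOfCubeDataThmD

end

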